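import Literature.AlgebraicGeometry.Resolution.RationalFunctionsToProjectiveSpace
import HarnessLib

/-!
# Rational maps to projective space from a vector of rational functions: the converse and
# uniqueness

Topic: `Literature/AlgebraicGeometry/Resolution`. Sequel to `RationalFunctionsToProjectiveSpace`:
for an integral scheme `X` over a field `k` and `z ∈ K(X)ⁿ⁺¹ ∖ 0`, a `k`-morphism
`r : X → ℙⁿ_k` whose `K(X)`-point is the point with homogeneous coordinates `z`
(`Motives.ProjectiveSpace.pointOfVec k z`) IS the rational map `(z₀ : … : zₙ)`: on `r⁻¹ D₊(xᵢ)` the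
pulled-back coordinate ratio `r^*(x_j/xᵢ)` (tree `Motives.GeneratingSections.homRatio`) has
generic value `z_j/zᵢ`, so `z_j/zᵢ` is regular there (Hartshorne II Thm. 7.1 (a): "`sᵢ = φ^*(xᵢ)`").
Everything PROVED:

* `fromSpecStalk_appLE_comp_ΓSpecIso_hom` — evaluating a section at the canonical point
  `Spec 𝒪_{X,x} → X` is taking its germ; `evalAt_fromSpecStalk`;
* `evalAt_homRatio` — the value of `r^*(x_j/xᵢ)` at an `R`-point `κ` of `r⁻¹ D₊(xᵢ)` is read off
  the chart map `Spec R → D₊(xᵢ) = Spec k[x]_{(xᵢ)}`; `evalAt_homRatio_of_comp_eq` — if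
  `κ ≫ r = Spec(e) ≫ (D₊(xᵢ) ↪ ℙⁿ)` for a ring map `e`, that value is `e(x_j/xᵢ)`;
* `ofSection_homRatio_eq_div` — with `K(X)`-point `pointOfVec k z`: the generic value of
  `r^*(x_j/xᵢ)` is `z_j/zᵢ`;
* **`isDefinedAt_of_comp_eq_pointOfVec`** — hence `(z₀ : … : zₙ)` is defined everywhere on `X`;
* **`eq_toProjOfVec`** — and `r` is the morphism `toProjOfVec z` (two `k`-morphisms from the
  integral `X` to the separated `ℙⁿ_k` agreeing at the generic point coincide).

## References

* R. Hartshorne, *Algebraic Geometry* (1977), II Thm. 7.1 (a) and its proof. [Hartshorne1977]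
* U. Görtz, T. Wedhorn, *Algebraic Geometry I*, 2nd ed. (2020), (9.3), §13.8. [GortzWedhorn2020]
-/

noncomputable section

open CategoryTheory CategoryTheory.Limits AlgebraicGeometry TopologicalSpace Opposite
open HomogeneousLocalization
open Literature.AlgebraicGeometry.Motives Literature.AlgebraicGeometry.Motives.Segre

attribute [local instance] MvPolynomial.gradedAlgebra

namespace Literature.AlgebraicGeometry.Resolution

universe u

variable {X : Scheme.{u}}

/-! ## Evaluating sections at the canonical points `Spec 𝒪_{X,x} → X` -/

/-- **Evaluating a section at `Spec 𝒪_{X,x} → X` is taking its germ**: for an open `V ∋ x`,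
`Γ(X, V) → Γ(Spec 𝒪_{X,x}, 𝒪) ≅ 𝒪_{X,x}` is `germ_x` (Mathlib `Scheme.fromSpecStalk_app`).
[folklore] -/
@[reassoc]
theorem fromSpecStalk_appLE_comp_ΓSpecIso_hom (x : X) (V : X.Opens) (hxV : x ∈ V)
    (h : ⊤ ≤ X.fromSpecStalk x ⁻¹ᵁ V) :
    (X.fromSpecStalk x).appLE V ⊤ h ≫ (Scheme.ΓSpecIso (X.presheaf.stalk x)).hom =
      X.presheaf.germ V x hxV := by
  have hid : ∀ g : (op (⊤ : (Spec (X.presheaf.stalk x)).Opens)) ⟶ op ⊤,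
      (Spec (X.presheaf.stalk x)).presheaf.map g = 𝟙 _ := fun g => by
    rw [Subsingleton.elim g (𝟙 _), CategoryTheory.Functor.map_id]
  rw [Scheme.Hom.appLE, Scheme.fromSpecStalk_app hxV]
  simp only [Category.assoc]
  rw [← CategoryTheory.Functor.map_comp_assoc, hid, Category.id_comp, Iso.inv_hom_id,
    Category.comp_id]

/-- The value at `Spec 𝒪_{X,x} → X` of a section is its germ at `x`. [folklore] -/
theorem evalAt_fromSpecStalk (x : X) (V : X.Opens) (hxV : x ∈ V)
    (h : ⊤ ≤ X.fromSpecStalk x ⁻¹ᵁ V) (s : Γ(X, V)) :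
    evalAt (X.fromSpecStalk x) V h s = X.presheaf.germ V x hxV s :=
  congrArg (fun φ => φ.hom s) (fromSpecStalk_appLE_comp_ΓSpecIso_hom x V hxV h)

/-- `evalAt` only depends on the morphism (the proof that it lands in `V` is irrelevant).
[folklore] -/
theorem evalAt_congr {R : CommRingCat.{u}} {κ₁ κ₂ : Spec R ⟶ X} (e : κ₁ = κ₂) (V : X.Opens)
    (h₁ : ⊤ ≤ κ₁ ⁻¹ᵁ V) (h₂ : ⊤ ≤ κ₂ ⁻¹ᵁ V) (s : Γ(X, V)) :
    evalAt κ₁ V h₁ s = evalAt κ₂ V h₂ s := by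
  subst e
  rfl

/-- Every point of `Spec 𝒪_{X,x}` maps to a generization of `x`; so `Spec 𝒪_{X,x} → X` lands in
every open neighbourhood of `x`. [folklore] -/
theorem top_le_fromSpecStalk_preimage {x : X} {V : X.Opens} (hxV : x ∈ V) :
    ⊤ ≤ X.fromSpecStalk x ⁻¹ᵁ V := by
  rintro p -
  show X.fromSpecStalk x p ∈ V
  have hp : X.fromSpecStalk x p ∈ Set.range (X.fromSpecStalk x) := ⟨p, rfl⟩
  rw [Scheme.range_fromSpecStalk] at hp
  exact hp.mem_open V.isOpen hxV

/-! ## The value of `r^*(x_j/xᵢ)` at a point of `r⁻¹ D₊(xᵢ)` -/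

section HomRatio

variable {n : ℕ} {k : Type u} [Field k] (r : X ⟶ Proj (grading (Fin (n + 1)) k))

/-- `U.ι^*` from `Γ(X, U)` to `Γ(U, ⊤)` is the inverse of `U.topIso` (both are restriction maps of
`𝒪_X` along the same inequality of opens; a private copy of the lemma of the same name in
`BlowupPrincipalCharts.lean`, to keep the imports light). [folklore] -/
private theorem ι_appLE_eq_topIso_inv (U : X.Opens) (h : ⊤ ≤ U.ι ⁻¹ᵁ U) :
    U.ι.appLE U ⊤ h = U.topIso.inv := by
  simp only [Scheme.Opens.ι_appLE, Scheme.Opens.topIso_inv]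
  congr 1

/-- Pulling a section of `Γ(U, ⊤)` transported to `Γ(X, U)` back along `U ↪ X` returns it.
[folklore] -/
theorem res_ι_topIso_hom (U : X.Opens) (h : ⊤ ≤ U.ι ⁻¹ᵁ U) (t : Γ(U, ⊤)) :
    GeneratingSections.res U.ι U h (U.topIso.hom t) = t := by
  rw [GeneratingSections.res, ι_appLE_eq_topIso_inv, ← CommRingCat.comp_apply, Iso.hom_inv_id,
    CommRingCat.id_apply]

/-- **The value of `r^*(x_j/xᵢ)` at a `T`-point of `r⁻¹ D₊(xᵢ)`**: for `κ' : T → r⁻¹D₊(xᵢ)`, the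
pullback of `r^*(x_j/xᵢ)` along `κ' ≫ (r⁻¹D₊(xᵢ) ↪ X)` is the pullback of `x_j/xᵢ` along the chart
map `T → r⁻¹D₊(xᵢ) → Spec k[x]_{(xᵢ)}`. [folklore] -/
theorem res_comp_ι_homRatio {T : Scheme.{u}} {i : Fin (n + 1)}
    (κ' : T ⟶ (GeneratingSections.preU r i : X.Opens))
    (h : ⊤ ≤ (κ' ≫ (GeneratingSections.preU r i).ι) ⁻¹ᵁ GeneratingSections.preU r i)
    (j : Fin (n + 1)) :
    GeneratingSections.res (κ' ≫ (GeneratingSections.preU r i).ι) (GeneratingSections.preU r i) h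
        (GeneratingSections.homRatio r i j) =
      pull (κ' ≫ GeneratingSections.chartLift r i) (frac k i j) := by
  rw [GeneratingSections.res_comp (GeneratingSections.preU r i).ι (GeneratingSections.preU r i)
      (GeneratingSections.preU r i).ι_preimage_self.ge κ' h,
    RingHom.comp_apply, GeneratingSections.homRatio, res_ι_topIso_hom, pull_comp]
  rfl

/-- The same for an `R`-valued point, read in `R` (`evalAt`). [folklore] -/
theorem evalAt_comp_ι_homRatio {R : CommRingCat.{u}} {i : Fin (n + 1)}
    (κ' : Spec R ⟶ (GeneratingSections.preU r i : X.Opens))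
    (h : ⊤ ≤ (κ' ≫ (GeneratingSections.preU r i).ι) ⁻¹ᵁ GeneratingSections.preU r i)
    (j : Fin (n + 1)) :
    evalAt (κ' ≫ (GeneratingSections.preU r i).ι) (GeneratingSections.preU r i) h
        (GeneratingSections.homRatio r i j) =
      (Scheme.ΓSpecIso R).hom (pull (κ' ≫ GeneratingSections.chartLift r i) (frac k i j)) := by
  rw [evalAt, res_comp_ι_homRatio]

/-- If the `R`-point `κ' ≫ ι` of `X` maps under `r` to `Spec R → Spec k[x]_{(xᵢ)} ↪ ℙⁿ` given by a
ring map `e`, the value of `r^*(x_j/xᵢ)` at it is `e(x_j/xᵢ)`. [folklore] -/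
theorem evalAt_comp_ι_homRatio_of_comp_eq {R : CommRingCat.{u}} {i : Fin (n + 1)}
    (κ' : Spec R ⟶ (GeneratingSections.preU r i : X.Opens))
    (h : ⊤ ≤ (κ' ≫ (GeneratingSections.preU r i).ι) ⁻¹ᵁ GeneratingSections.preU r i)
    (e : Away (grading (Fin (n + 1)) k) (MvPolynomial.X i) →+* R)
    (he : (κ' ≫ (GeneratingSections.preU r i).ι) ≫ r = Spec.map (CommRingCat.ofHom e) ≫ chartι k i)
    (j : Fin (n + 1)) :
    evalAt (κ' ≫ (GeneratingSections.preU r i).ι) (GeneratingSections.preU r i) h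
        (GeneratingSections.homRatio r i j) = e (frac k i j) := by
  rw [evalAt_comp_ι_homRatio]
  have hlift : κ' ≫ GeneratingSections.chartLift r i = Spec.map (CommRingCat.ofHom e) := by
    rw [← cancel_mono (chartι k i), Category.assoc, GeneratingSections.chartLift_chartι,
      ← Category.assoc, he]
  rw [hlift, show Spec.map (CommRingCat.ofHom e) = 𝟙 _ ≫ Spec.map (CommRingCat.ofHom e) from
    (Category.id_comp _).symm, pull_SpecMap, pull_apply, Scheme.Hom.id_appTop]
  simp only [CommRingCat.hom_ofHom, CommRingCat.id_apply]
  exact (Scheme.ΓSpecIso R).inv_hom_id_apply _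

end HomRatio

/-! ## The converse: a morphism with generic point `(z₀ : … : zₙ)` is `toProjOfVec z` -/

section Converse

open MvPolynomial HomogeneousLocalization

attribute [local instance] ProjBaseChange.algebraBase

variable [IsIntegral X] {n : ℕ} (z : Fin (n + 1) → X.functionField) {k : Type u} [Field k]
  [Algebra k X.functionField] (r : X ⟶ Proj (grading (Fin (n + 1)) k)) (hz : z ≠ 0)
  (hr : X.fromSpecStalk (genericPoint X) ≫ r = (ProjectiveSpace.pointOfVec k z hz).left)

include hr in
/-- If `r` has `K(X)`-point `pointOfVec k z` and `r⁻¹D₊(xᵢ)` is non-empty, then `zᵢ ≠ 0`. [folklore] -/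
theorem ne_zero_of_genericPoint_mem_preU {i : Fin (n + 1)}
    (hη : genericPoint X ∈ GeneratingSections.preU r i) : z i ≠ 0 := by
  have hpt : (ProjectiveSpace.pointOfVec k z hz).pt = r (genericPoint X) := by
    have := congrArg (fun φ => φ (IsLocalRing.closedPoint X.functionField)) hr
    simp only [Scheme.Hom.comp_apply, Scheme.fromSpecStalk_closedPoint] at this
    exact this.symm
  rw [← ProjectiveSpace.pt_pointOfVec_mem_basicOpen_X_iff (k := k) z hz i, hpt]
  exact hη

include hr in
/-- **The generic value of `r^*(x_j/xᵢ)` is `z_j/zᵢ`** when the `K(X)`-point of `r` is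
`(z₀ : … : zₙ)` (Hartshorne II Thm. 7.1 (a): `sᵢ = φ^*(xᵢ)`). [cite: Hartshorne1977, II Thm. 7.1 (a)] -/
theorem ofSection_homRatio_eq_div {i : Fin (n + 1)}
    (hη : genericPoint X ∈ GeneratingSections.preU r i) (j : Fin (n + 1)) :
    RatFn.ofSection hη (GeneratingSections.homRatio r i j) = z j / z i := by
  have hi : z i ≠ 0 := ne_zero_of_genericPoint_mem_preU z r hz hr hη
  have hzi : aeval z (MvPolynomial.X i : MvPolynomial _ k) ≠ 0 := by rwa [aeval_X]
  set U := GeneratingSections.preU r i with hU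
  -- the generic point of `X` as a point of the open `U`
  let κ' := U.fromSpecStalkOfMem (genericPoint X) hη
  have hκ' : κ' ≫ U.ι = X.fromSpecStalk (genericPoint X) := U.fromSpecStalkOfMem_ι _ hη
  have h : ⊤ ≤ (κ' ≫ U.ι) ⁻¹ᵁ U := by
    rw [hκ']
    exact top_le_fromSpecStalk_preimage hη
  have he : (κ' ≫ U.ι) ≫ r =
      Spec.map (CommRingCat.ofHom (ProjectiveSpace.awayEval z hzi).toRingHom) ≫ chartι k i := by
    rw [hκ', hr, ProjectiveSpace.pointOfVec_eq_chartPoint z hz (Segre.X_mem k i) one_pos hzi]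
    rfl
  rw [RatFn.ofSection, ← evalAt_fromSpecStalk (genericPoint X) U hη
      (top_le_fromSpecStalk_preimage hη), ← evalAt_congr hκ' U h,
    evalAt_comp_ι_homRatio_of_comp_eq r κ' h _ he j]
  show ProjectiveSpace.awayEval z hzi (frac k i j) = z j / z i
  rw [show frac k i j = Away.mk _ (Segre.X_mem k i) 1 (MvPolynomial.X j ^ 1)
      (by simpa using Segre.X_mem k j) from rfl,
    ProjectiveSpace.awayEval_mk z hzi (Segre.X_mem k i), pow_one, pow_one, aeval_X, aeval_X]

include hr in
/-- **A morphism to `ℙⁿ_k` with generic point `(z₀ : … : zₙ)` forces the rational map to be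
defined everywhere**: every `x ∈ X` lies in some `r⁻¹D₊(xᵢ)`, on which `z_j/zᵢ = r^*(x_j/xᵢ)` is
regular for all `j`. [cite: Hartshorne1977, II Thm. 7.1 (a)] -/
theorem isDefinedAt_of_comp_eq_pointOfVec (x : X) : IsDefinedAt z x := by
  obtain ⟨i, hxi⟩ : ∃ i, x ∈ GeneratingSections.preU r i := by
    have := (GeneratingSections.iSup_preU r).ge (Set.mem_univ x)
    exact Opens.mem_iSup.mp this
  have hη : genericPoint X ∈ GeneratingSections.preU r i := RatFn.genericPoint_mem_of_mem hxi
  refine ⟨i, (mem_lsChart_iff z).mpr ⟨ne_zero_of_genericPoint_mem_preU z r hz hr hη, fun j => ?_⟩⟩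
  rw [← ofSection_homRatio_eq_div z r hz hr hη j]
  exact RatFn.isRegularAt_ofSection hxi _

/-- `Spec K(X) → X` is dominant. [folklore] -/
theorem isDominant_fromSpecStalk_genericPoint : IsDominant (X.fromSpecStalk (genericPoint X)) := by
  refine ⟨?_⟩
  have h : genericPoint X ∈ Set.range (X.fromSpecStalk (genericPoint X)) :=
    ⟨IsLocalRing.closedPoint _, X.fromSpecStalk_closedPoint⟩
  have hc : closure {genericPoint X} = (Set.univ : Set X) := genericPoint_spec X
  rw [DenseRange, dense_iff_closure_eq, ← Set.univ_subset_iff, ← hc]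
  exact closure_mono (Set.singleton_subset_iff.mpr h)

include hr in
/-- **Uniqueness**: a `k`-morphism `r : X → ℙⁿ_k` with `K(X)`-point `(z₀ : … : zₙ)` is the morphism
`toProjOfVec z` of the linear system (both are `k`-morphisms from the integral `X` to the separated
`ℙⁿ_k` agreeing at the generic point, Mathlib `ext_of_isDominant_of_isSeparated`).
[cite: Hartshorne1977, II Thm. 7.1 (b)] -/
theorem eq_toProjOfVec (f : X ⟶ Spec (.of k)) (hrf : r ≫ toSpec (Fin (n + 1)) k = f)
    (hgen : X.fromSpecStalk (genericPoint X) ≫ f =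
      Spec.map (CommRingCat.ofHom (algebraMap k X.functionField))) :
    r = toProjOfVec z f (isDefinedAt_of_comp_eq_pointOfVec z r hz hr) := by
  haveI := isDominant_fromSpecStalk_genericPoint (X := X)
  apply ext_of_isDominant_of_isSeparated (toSpec (Fin (n + 1)) k)
    (ι := X.fromSpecStalk (genericPoint X))
  · rw [hrf, toProjOfVec_toSpec]
  · rw [hr, fromSpecStalk_genericPoint_toProjOfVec z f _ hgen hz]

end Converse

end Literature.AlgebraicGeometry.Resolution

end
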